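import Literature.Geometry.Kaehler.FibreDiffeomorphism
import HarnessLib

/-!
# The Ehresmann trivialisation of a proper holomorphic submersion over a holomorphic chart ball

Layer `Literature/Geometry/Kaehler` (carriers `IsProperHolomorphicSubmersion`, `IsFibreEmbedding` of
`DeformationEquivalence`). Theorems only; no definition, no named fact. Written by the prover seat
`hodge-nonav-prover-Ax` (g12, cell `hodge-nonav`) as the geometric half (brick F-C, part 1) of the
programme «GRIFFITHS-SURFACES / B4 RELATIVE RESIDUES» (route `HodgeConjecture/CyclicUnitaryPowers`):
the holomorphy of the periods of relative holomorphic forms (Griffiths 1968; Voisin I §9.1–9.3, §10.2)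
is read through the `C^∞` trivialisation of the family near a fibre, parametrised by the COMPLEX chart
coordinates of the base.

Let `π : 𝒳 → B` be a proper holomorphic submersion of complex manifolds (`𝒳` Hausdorff, second
countable), `O ∋ s₀` an open set of `B` over which fibre models `ι b : X b ≅ π⁻¹(b)` are given
(`IsFibreEmbedding`; all `X b` charted on one model space `EX`), and `c = extChartAt 𝓘(ℂ, EB) s₀` the
holomorphic chart of `B` at `s₀`. From the tree's PROVED Ehresmann theorem with base coordinate and
translation law (`Geometry.Manifold.exists_localTrivialisation_translate`; Bröcker–Jänich (8.12),
Kodaira Thm. 2.5, Voisin I Thm. 9.3 / Prop. 9.5) we build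
(`IsProperHolomorphicSubmersion.exists_chartBall_trivialisation`) a radius `r > 0` with
`ball (c s₀) r ⊆ c.target`, `c⁻¹(ball) ⊆ O`, and a map `Φ : EB → X s₀ → 𝒳`,
`Φ p x = Tr (τ (c⁻¹ p), ι s₀ x)`, with

* `Φ (c s₀) = ι s₀` (the central fibre embedding);
* `π (Φ p x) = c⁻¹ p` for `p ∈ ball`: `Φ p` parametrises the fibre over `c⁻¹ p`;
* `Φ` is JOINTLY `C^∞` on `ball × X s₀` (real structures; the chart inverse `c⁻¹` and `τ` are `C^∞`);
* for every `p ∈ ball`, `Φ p` is a `C^∞` injective immersion onto `π⁻¹(c⁻¹ p)` (transport step of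
  Kodaira's Thm. 2.3, `immersedFibre_comp` — the tree's `exists_immersedFibre_comp` with the composite
  made explicit), hence `Φ p = ι (c⁻¹ p) ∘ e_p` for a `C^∞` DIFFEOMORPHISM `e_p : X s₀ ≅ X (c⁻¹ p)` (two
  embeddings with the same image, Lee Thm. 5.31, `exists_diffeomorph_comp_eq_of_range_eq`).

Also recorded: `exists_mfderiv_eq_of_mfderiv_proj_eq_zero` — along a fibre embedding the tangent space
of the fibre IS the kernel of `dπ` (real differentials): `range d(ι b)_x = ker dπ_{ι b x}` as soon as
`dim EX + dim EB = dim E𝒳` (rank count: `dπ` onto, `dι` injective, `dπ ∘ dι = 0`) — the hypothesis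
`hvert` of the period computation `PeriodIntegralHolomorphicVertical`.

## References

* [Kodaira2005] K. Kodaira, Complex Manifolds and Deformation of Complex Structures (2005), §2.3
  Thm. 2.3, Thm. 2.5.
* [VoisinHodgeI2002] C. Voisin, Hodge Theory and Complex Algebraic Geometry I (2002), §9.1.1 Thm. 9.3,
  Prop. 9.5; §9.1.2.
* [BrockerJanichIDT1982] Th. Bröcker, K. Jänich, Introduction to Differential Topology (1982), (8.12).
* [LeeSmoothManifolds2013] J. M. Lee, Introduction to Smooth Manifolds, 2nd ed. (2013), Thm. 5.31.
-/

noncomputable section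

open scoped Manifold ContDiff Topology
open Function Set Filter Metric
open Literature.Geometry.Manifold

namespace Literature.Geometry.Kaehler

universe u

-- The identification `TangentSpace I x = E` is an abuse of definitional equality; as in the tree's
-- manifold files we let `isDefEq` unfold it.
set_option backward.isDefEq.respectTransparency false

/-! ### Transport of a fibre embedding by a tube diffeomorphism (explicit composite) -/

section Transport

variable {EX : Type*} [NormedAddCommGroup EX] [NormedSpace ℝ EX]
  {X : Type*} [TopologicalSpace X] [ChartedSpace EX X]
  {ET : Type*} [NormedAddCommGroup ET] [NormedSpace ℝ ET]
  {T : Type*} [TopologicalSpace T] [ChartedSpace ET T]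
  {B : Type*} {π : T → B}

/-- **Transport step of Kodaira's Thm. 2.3, with the transported embedding made explicit** (the
tree's `exists_immersedFibre_comp` states `∃ e'`; here `e' = A ∘ e`). Let `W ⊆ T` be open and
`A, A' : T → T` be `C^∞` on `W`, with `A(W) ⊆ W`, `A' ∘ A = id` on `W`, `A` carrying the fibre
`π⁻¹(b) ⊆ W` into `π⁻¹(b')` and `A'` carrying `π⁻¹(b')` back into `π⁻¹(b)` with `A ∘ A' = id` there. If
`e : X → T` is a `C^∞` injective immersion onto `π⁻¹(b)`, then `A ∘ e` is a `C^∞` injective immersion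
onto `π⁻¹(b')`. [cite: Kodaira2005, §2.3 Thm. 2.3 (proof via Thm. 2.5)] -/
theorem immersedFibre_comp {W : Set T} (hW : IsOpen W) {A A' : T → T}
    (hA : ContMDiffOn 𝓘(ℝ, ET) 𝓘(ℝ, ET) ∞ A W) (hA' : ContMDiffOn 𝓘(ℝ, ET) 𝓘(ℝ, ET) ∞ A' W)
    (hAW : MapsTo A W W) (hA'A : ∀ y ∈ W, A' (A y) = y) {b b' : B} (hbW : π ⁻¹' {b} ⊆ W)
    (hAb : ∀ y, π y = b → π (A y) = b')
    (hA'b : ∀ y, π y = b' → π (A' y) = b ∧ A (A' y) = y)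
    {e : X → T} (he : ContMDiff 𝓘(ℝ, EX) 𝓘(ℝ, ET) ∞ e) (hinj : Injective e)
    (hd : ∀ x, Injective (mfderiv 𝓘(ℝ, EX) 𝓘(ℝ, ET) e x)) (hrange : range e = π ⁻¹' {b}) :
    ContMDiff 𝓘(ℝ, EX) 𝓘(ℝ, ET) ∞ (fun x ↦ A (e x)) ∧ Injective (fun x ↦ A (e x)) ∧
      (∀ x, Injective (mfderiv 𝓘(ℝ, EX) 𝓘(ℝ, ET) (fun x ↦ A (e x)) x)) ∧
      range (fun x ↦ A (e x)) = π ⁻¹' {b'} := by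
  -- adapted from the tree's `exists_immersedFibre_comp` (FibreDiffeomorphism), same proof
  have heW : ∀ x, e x ∈ W := fun x ↦ hbW (hrange ▸ mem_range_self x)
  have heb : ∀ x, π (e x) = b := fun x ↦ by
    simpa using (hrange ▸ mem_range_self x : e x ∈ π ⁻¹' {b})
  refine ⟨hA.comp_contMDiff he heW, ?_, ?_, ?_⟩
  · intro x x' h
    apply hinj
    have h' := congrArg A' h
    simp only [hA'A _ (heW x), hA'A _ (heW x')] at h'
    exact h'
  · intro x
    have hAd : MDifferentiableAt 𝓘(ℝ, ET) 𝓘(ℝ, ET) A (e x) :=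
      ((hA _ (heW x)).contMDiffAt (hW.mem_nhds (heW x))).mdifferentiableAt (by simp)
    have hA'd : MDifferentiableAt 𝓘(ℝ, ET) 𝓘(ℝ, ET) A' (A (e x)) :=
      ((hA' _ (hAW (heW x))).contMDiffAt (hW.mem_nhds (hAW (heW x)))).mdifferentiableAt (by simp)
    have hed : MDifferentiableAt 𝓘(ℝ, EX) 𝓘(ℝ, ET) e x := he.mdifferentiableAt (by simp)
    have heq : (A' ∘ A) =ᶠ[𝓝 (e x)] id :=
      Filter.eventually_of_mem (hW.mem_nhds (heW x)) fun y hy ↦ hA'A y hy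
    have hD : HasMFDerivAt 𝓘(ℝ, ET) 𝓘(ℝ, ET) (A' ∘ A) (e x)
        ((mfderiv 𝓘(ℝ, ET) 𝓘(ℝ, ET) A' (A (e x))).comp (mfderiv 𝓘(ℝ, ET) 𝓘(ℝ, ET) A (e x))) :=
      hA'd.hasMFDerivAt.comp (e x) hAd.hasMFDerivAt
    have hI : HasMFDerivAt 𝓘(ℝ, ET) 𝓘(ℝ, ET) (A' ∘ A) (e x)
        (ContinuousLinearMap.id ℝ (TangentSpace 𝓘(ℝ, ET) (e x))) :=
      (hasMFDerivAt_id (e x)).congr_of_eventuallyEq heq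
    have key : ∀ v, mfderiv 𝓘(ℝ, ET) 𝓘(ℝ, ET) A' (A (e x)) (mfderiv 𝓘(ℝ, ET) 𝓘(ℝ, ET) A (e x) v) = v :=
      fun v ↦ by
        have h := DFunLike.congr_fun (hasMFDerivAt_unique hD hI) v
        exact h
    have hAinj : Injective (mfderiv 𝓘(ℝ, ET) 𝓘(ℝ, ET) A (e x)) := by
      intro v w hvw
      rw [← key v, ← key w, hvw]
    have hcomp : mfderiv 𝓘(ℝ, EX) 𝓘(ℝ, ET) (fun x ↦ A (e x)) x =
        (mfderiv 𝓘(ℝ, ET) 𝓘(ℝ, ET) A (e x)).comp (mfderiv 𝓘(ℝ, EX) 𝓘(ℝ, ET) e x) :=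
      mfderiv_comp x hAd hed
    rw [hcomp]
    exact hAinj.comp (hd x)
  · ext y
    constructor
    · rintro ⟨x, rfl⟩
      simpa using hAb (e x) (heb x)
    · intro hy
      have hy' : π y = b' := by simpa using hy
      obtain ⟨h1, h2⟩ := hA'b y hy'
      have hmem : A' y ∈ range e := by
        rw [hrange]
        simpa using h1
      obtain ⟨x, hx⟩ := hmem
      exact ⟨x, by simp only [hx, h2]⟩

end Transport

/-! ### The tangent space of a fibre is the kernel of `dπ` -/

section Vertical

variable {EX : Type u} [NormedAddCommGroup EX] [NormedSpace ℂ EX] [FiniteDimensional ℂ EX]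
  {X : Type u} [TopologicalSpace X] [ChartedSpace EX X]
  {E𝒳 : Type u} [NormedAddCommGroup E𝒳] [NormedSpace ℂ E𝒳] [FiniteDimensional ℂ E𝒳]
  {𝒳 : Type u} [TopologicalSpace 𝒳] [ChartedSpace E𝒳 𝒳]
  {EB : Type u} [NormedAddCommGroup EB] [NormedSpace ℂ EB] [FiniteDimensional ℂ EB]
  {B : Type u} [TopologicalSpace B] [ChartedSpace EB B]
  {π : 𝒳 → B}

omit [FiniteDimensional ℂ EX] in
/-- **Along a fibre embedding the tangent space of the fibre is the kernel of `dπ`**: for a proper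
holomorphic submersion `π`, a fibre embedding `ι : X ≅ π⁻¹(b)` and `dim EX + dim EB = dim E𝒳`, every
REAL tangent vector `w` at `ι x` with `dπ(w) = 0` is `dι_x(w')` for some `w'` (`dπ ∘ dι = d(π ∘ ι) = 0`,
`dι` injective, `dπ` onto: rank count over `ℝ`). This is the verticality hypothesis `hvert` of
`differentiableAt_complex_cintegral_wedge_pullback_family_of_vertical`.
[cite: VoisinHodgeI2002, §9.1.2 (the vertical tangent bundle)] -/
theorem exists_mfderiv_eq_of_mfderiv_proj_eq_zero [IsManifold 𝓘(ℂ, E𝒳) ω 𝒳] [IsManifold 𝓘(ℂ, EB) ω B]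
    [IsManifold 𝓘(ℂ, EX) ω X] (hπ : IsProperHolomorphicSubmersion E𝒳 EB π) {b : B} {ι : X → 𝒳}
    (hι : IsFibreEmbedding EX E𝒳 π b ι)
    (hdim : Module.finrank ℂ EX + Module.finrank ℂ EB = Module.finrank ℂ E𝒳) (x : X) (w : E𝒳)
    (hw : mfderiv 𝓘(ℝ, E𝒳) 𝓘(ℝ, EB) π (ι x) w = 0) :
    ∃ w' : EX, mfderiv 𝓘(ℝ, EX) 𝓘(ℝ, E𝒳) ι x w' = w := by
  haveI : IsManifold 𝓘(ℝ, E𝒳) ∞ 𝒳 := isManifold_real_of_isManifold_complex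
  haveI : IsManifold 𝓘(ℝ, EB) ∞ B := isManifold_real_of_isManifold_complex
  haveI : IsManifold 𝓘(ℝ, EX) ∞ X := isManifold_real_of_isManifold_complex
  haveI : FiniteDimensional ℝ E𝒳 := FiniteDimensional.complexToReal E𝒳
  haveI : FiniteDimensional ℝ EB := FiniteDimensional.complexToReal EB
  -- the three real differentials
  set Dι : EX →ₗ[ℝ] E𝒳 := (mfderiv 𝓘(ℝ, EX) 𝓘(ℝ, E𝒳) ι x : EX →L[ℝ] E𝒳).toLinearMap with hDι
  set Dπ : E𝒳 →ₗ[ℝ] EB := (mfderiv 𝓘(ℝ, E𝒳) 𝓘(ℝ, EB) π (ι x) : E𝒳 →L[ℝ] EB).toLinearMap with hDπ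
  have hιd : MDifferentiableAt 𝓘(ℝ, EX) 𝓘(ℝ, E𝒳) ι x := hι.contMDiff_real.mdifferentiableAt (by simp)
  have hπd : MDifferentiableAt 𝓘(ℝ, E𝒳) 𝓘(ℝ, EB) π (ι x) :=
    (contMDiff_real_of_mdifferentiable (n := ∞)
      (hπ.contMDiff.mdifferentiable (by simp))).mdifferentiableAt (by simp)
  -- `dπ ∘ dι = 0` since `π ∘ ι` is constant
  have hcomp : Dπ ∘ₗ Dι = 0 := by
    have hconst : π ∘ ι = fun _ ↦ b := funext fun y ↦ hι.apply_eq y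
    have h1 : mfderiv 𝓘(ℝ, EX) 𝓘(ℝ, EB) (π ∘ ι) x =
        (mfderiv 𝓘(ℝ, E𝒳) 𝓘(ℝ, EB) π (ι x)).comp (mfderiv 𝓘(ℝ, EX) 𝓘(ℝ, E𝒳) ι x) :=
      mfderiv_comp x hπd hιd
    have h2 : mfderiv 𝓘(ℝ, EX) 𝓘(ℝ, EB) (π ∘ ι) x = 0 := by
      rw [hconst]; exact mfderiv_const
    apply LinearMap.ext
    intro v
    have := DFunLike.congr_fun (h1.symm.trans h2) v
    change (mfderiv 𝓘(ℝ, E𝒳) 𝓘(ℝ, EB) π (ι x)) ((mfderiv 𝓘(ℝ, EX) 𝓘(ℝ, E𝒳) ι x) v) = 0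
    exact this
  have hle : LinearMap.range Dι ≤ LinearMap.ker Dπ := by
    rintro _ ⟨v, rfl⟩
    rw [LinearMap.mem_ker]
    have := LinearMap.congr_fun hcomp v
    simpa using this
  -- rank count
  have hinj : Function.Injective Dι := hι.injective_mfderiv_real x
  have hsurj : Function.Surjective Dπ := hπ.surjective_mfderiv_real (ι x)
  have hrk : Module.finrank ℝ (LinearMap.range Dι) = Module.finrank ℝ EX :=
    LinearMap.finrank_range_of_inj hinj
  have hker : Module.finrank ℝ (LinearMap.ker Dπ) + Module.finrank ℝ EB = Module.finrank ℝ E𝒳 := by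
    have h := LinearMap.finrank_range_add_finrank_ker Dπ
    rw [LinearMap.range_eq_top.2 hsurj, finrank_top] at h
    omega
  have hdimℝ : Module.finrank ℝ EX + Module.finrank ℝ EB = Module.finrank ℝ E𝒳 := by
    rw [finrank_real_of_complex, finrank_real_of_complex, finrank_real_of_complex, ← hdim]
    ring
  have heq : LinearMap.range Dι = LinearMap.ker Dπ :=
    Submodule.eq_of_le_of_finrank_eq hle (by omega)
  have hwk : w ∈ LinearMap.ker Dπ := by
    rw [LinearMap.mem_ker]
    exact hw
  rw [← heq] at hwk
  obtain ⟨w', hw'⟩ := hwk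
  exact ⟨w', hw'⟩

end Vertical

/-! ### The trivialisation over a holomorphic chart ball -/

section ChartBall

variable {EX : Type u} [NormedAddCommGroup EX] [NormedSpace ℂ EX] [FiniteDimensional ℂ EX]
  {E𝒳 : Type u} [NormedAddCommGroup E𝒳] [NormedSpace ℂ E𝒳] [FiniteDimensional ℂ E𝒳]
  {𝒳 : Type u} [TopologicalSpace 𝒳] [ChartedSpace E𝒳 𝒳] [IsManifold 𝓘(ℂ, E𝒳) ω 𝒳]
  [T2Space 𝒳] [SecondCountableTopology 𝒳]
  {EB : Type u} [NormedAddCommGroup EB] [NormedSpace ℂ EB] [FiniteDimensional ℂ EB]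
  {B : Type u} [TopologicalSpace B] [ChartedSpace EB B] [IsManifold 𝓘(ℂ, EB) ω B]
  {π : 𝒳 → B}

/-- **The Ehresmann trivialisation of a proper holomorphic submersion over a holomorphic chart ball
of the base** (Kodaira Thm. 2.5 / Voisin I Thm. 9.3, Prop. 9.5, in the tree's local `C^∞` form
`exists_localTrivialisation_translate`, reparametrised by the chart `c = extChartAt 𝓘(ℂ, EB) s₀`).
Data: `π : 𝒳 → B` a proper holomorphic submersion (`𝒳` Hausdorff, second countable), `O ∋ s₀` open,
fibre models `ι b : X b ≅ π⁻¹(b)` for `b ∈ O` (all charted on `EX`). Conclusion: a radius `r > 0`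
with `ball (c s₀) r ⊆ c.target` and `c⁻¹(ball) ⊆ O`, and `Φ : EB → X s₀ → 𝒳` with
(0) `Φ (c s₀) = ι s₀`; (1) `π (Φ p x) = c⁻¹ p` on the ball; (2) `Φ` jointly `C^∞` on `ball × X s₀`;
(3) every `Φ p`, `p ∈ ball`, is a `C^∞` injective immersion onto `π⁻¹(c⁻¹ p)`; (4) hence
`Φ p = ι (c⁻¹ p) ∘ e` for a `C^∞` diffeomorphism `e : X s₀ ≅ X (c⁻¹ p)` (Lee Thm. 5.31).
[cite: Kodaira2005, §2.3 Thm. 2.5 and Thm. 2.3] [cite: VoisinHodgeI2002, §9.1.1 Thm. 9.3 and Prop. 9.5]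
[cite: BrockerJanichIDT1982, (8.12)] [cite: LeeSmoothManifolds2013, Thm. 5.31] -/
theorem IsProperHolomorphicSubmersion.exists_chartBall_trivialisation
    (hπ : IsProperHolomorphicSubmersion E𝒳 EB π) {O : Set B} (hO : IsOpen O) {s₀ : B} (hs₀ : s₀ ∈ O)
    {X : B → Type u} [∀ b, TopologicalSpace (X b)] [∀ b, ChartedSpace EX (X b)]
    [∀ b, IsManifold 𝓘(ℂ, EX) ω (X b)] {ι : ∀ b, X b → 𝒳}
    (hι : ∀ b ∈ O, IsFibreEmbedding EX E𝒳 π b (ι b)) :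
    ∃ (r : ℝ) (Φ : EB → X s₀ → 𝒳), 0 < r ∧
      ball (extChartAt 𝓘(ℂ, EB) s₀ s₀) r ⊆ (extChartAt 𝓘(ℂ, EB) s₀).target ∧
      (∀ p ∈ ball (extChartAt 𝓘(ℂ, EB) s₀ s₀) r, (extChartAt 𝓘(ℂ, EB) s₀).symm p ∈ O) ∧
      (∀ x, Φ (extChartAt 𝓘(ℂ, EB) s₀ s₀) x = ι s₀ x) ∧
      (∀ p ∈ ball (extChartAt 𝓘(ℂ, EB) s₀ s₀) r, ∀ x, π (Φ p x) = (extChartAt 𝓘(ℂ, EB) s₀).symm p) ∧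
      ContMDiffOn (𝓘(ℝ, EB).prod 𝓘(ℝ, EX)) 𝓘(ℝ, E𝒳) ∞ (uncurry Φ)
        (ball (extChartAt 𝓘(ℂ, EB) s₀ s₀) r ×ˢ univ) ∧
      (∀ p ∈ ball (extChartAt 𝓘(ℂ, EB) s₀ s₀) r,
        ContMDiff 𝓘(ℝ, EX) 𝓘(ℝ, E𝒳) ∞ (Φ p) ∧ Injective (Φ p) ∧
          (∀ x, Injective (mfderiv 𝓘(ℝ, EX) 𝓘(ℝ, E𝒳) (Φ p) x)) ∧
          range (Φ p) = π ⁻¹' {(extChartAt 𝓘(ℂ, EB) s₀).symm p}) ∧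
      (∀ p ∈ ball (extChartAt 𝓘(ℂ, EB) s₀ s₀) r,
        ∃ e : X s₀ ≃ₘ^∞⟮𝓘(ℝ, EX), 𝓘(ℝ, EX)⟯ X ((extChartAt 𝓘(ℂ, EB) s₀).symm p),
          ∀ x, ι ((extChartAt 𝓘(ℂ, EB) s₀).symm p) (e x) = Φ p x) := by
  haveI : IsManifold 𝓘(ℝ, E𝒳) ∞ 𝒳 := isManifold_real_of_isManifold_complex
  haveI : IsManifold 𝓘(ℝ, EB) ∞ B := isManifold_real_of_isManifold_complex
  haveI : ∀ b, IsManifold 𝓘(ℝ, EX) ∞ (X b) := fun b ↦ isManifold_real_of_isManifold_complex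
  haveI : FiniteDimensional ℝ EX := FiniteDimensional.complexToReal EX
  haveI : FiniteDimensional ℝ E𝒳 := FiniteDimensional.complexToReal E𝒳
  haveI : FiniteDimensional ℝ EB := FiniteDimensional.complexToReal EB
  haveI : CompleteSpace EB := FiniteDimensional.complete ℂ EB
  -- Ehresmann over `O`
  have hπℝ : ContMDiff 𝓘(ℝ, E𝒳) 𝓘(ℝ, EB) ∞ π :=
    contMDiff_real_of_mdifferentiable (hπ.contMDiff.mdifferentiable (by simp))
  have hsub : ∀ x, π x ∈ O → Surjective (mfderiv 𝓘(ℝ, E𝒳) 𝓘(ℝ, EB) π x) :=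
    fun x _ ↦ hπ.surjective_mfderiv_real x
  have hprop : ∀ K ⊆ O, IsCompact K → IsCompact (π ⁻¹' K) :=
    fun K _ hK ↦ hπ.isProperMap.isCompact_preimage hK
  obtain ⟨V, W, τ, Tr, Sr, hVo, hs₀V, hVO, -, hW, hτ, hτinj, hτ₀, hTr, hSr, hTrW, hSrW, hSrTr, hTrSr,
    hTr0, hlaw⟩ :=
    Literature.Geometry.Manifold.exists_localTrivialisation_translate (IT := 𝓘(ℝ, E𝒳)) hπℝ hO hs₀
      hsub hprop
  have hWo : IsOpen W := hW ▸ hVo.preimage hπ.contMDiff.continuous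
  -- the chart `c` at `s₀` and a ball in its target over `V`
  set c := extChartAt 𝓘(ℂ, EB) s₀ with hc
  have hcℝ : extChartAt 𝓘(ℝ, EB) s₀ = c := rfl
  have hs₀c : s₀ ∈ c.source := mem_extChartAt_source s₀
  have hG : IsOpen (c.target ∩ c.symm ⁻¹' V) :=
    (continuousOn_extChartAt_symm s₀).isOpen_inter_preimage (isOpen_extChartAt_target s₀) hVo
  have hG₀ : c s₀ ∈ c.target ∩ c.symm ⁻¹' V :=
    ⟨c.map_source hs₀c, by rw [mem_preimage, extChartAt_to_inv]; exact hs₀V⟩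
  obtain ⟨r, hr, hball⟩ := Metric.isOpen_iff.1 hG (c s₀) hG₀
  have hbt : ball (c s₀) r ⊆ c.target := fun p hp ↦ (hball hp).1
  have hbV : ∀ p ∈ ball (c s₀) r, c.symm p ∈ V := fun p hp ↦ (hball hp).2
  -- fibres over `V` lie in the tube; `π` maps the tube to `V`
  have hfibW : ∀ b ∈ V, π ⁻¹' {b} ⊆ W := fun b hb y hy ↦ by
    rw [hW]
    have : π y = b := by simpa using hy
    simpa [this] using hb
  have hπW : ∀ y ∈ W, π y ∈ V := fun y hy ↦ by rwa [hW] at hy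
  have hι₀ := hι s₀ hs₀
  have hι₀W : ∀ x, ι s₀ x ∈ W := fun x ↦ hfibW s₀ hs₀V (by simpa using hι₀.apply_eq x)
  -- the trivialisation
  set Φ : EB → X s₀ → 𝒳 := fun p x ↦ Tr (τ (c.symm p), ι s₀ x) with hΦ
  -- (1) `π (Φ p x) = c⁻¹ p`
  have hπΦ : ∀ p ∈ ball (c s₀) r, ∀ x, π (Φ p x) = c.symm p := by
    intro p hp x
    apply hτinj (hπW _ (hTrW _ _ (hι₀W x))) (hbV p hp)
    rw [hlaw _ _ (hι₀W x), hι₀.apply_eq x, hτ₀, zero_add]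
  -- the slices `Tr (u, ·)`, `Sr (u, ·)`
  have hslice : ∀ (u) {F : EuclideanSpace ℝ (Fin (Module.finrank ℝ EB)) × 𝒳 → 𝒳},
      ContMDiffOn ((𝓘(ℝ, EuclideanSpace ℝ (Fin (Module.finrank ℝ EB)))).prod 𝓘(ℝ, E𝒳))
        𝓘(ℝ, E𝒳) ∞ F (univ ×ˢ W) →
      ContMDiffOn 𝓘(ℝ, E𝒳) 𝓘(ℝ, E𝒳) ∞ (fun y ↦ F (u, y)) W := fun u {F} hF ↦
    hF.comp (contMDiffOn_const.prodMk contMDiffOn_id) fun y hy ↦ ⟨mem_univ _, hy⟩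
  -- (3) each `Φ p` is a `C^∞` injective immersion onto its fibre
  have himm : ∀ p ∈ ball (c s₀) r,
      ContMDiff 𝓘(ℝ, EX) 𝓘(ℝ, E𝒳) ∞ (Φ p) ∧ Injective (Φ p) ∧
        (∀ x, Injective (mfderiv 𝓘(ℝ, EX) 𝓘(ℝ, E𝒳) (Φ p) x)) ∧
        range (Φ p) = π ⁻¹' {c.symm p} := by
    intro p hp
    set u := τ (c.symm p) with hu
    have hAb : ∀ y, π y = s₀ → π (Tr (u, y)) = c.symm p := fun y hy ↦ by
      have hyW : y ∈ W := hfibW s₀ hs₀V (by simpa using hy)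
      apply hτinj (hπW _ (hTrW u y hyW)) (hbV p hp)
      rw [hlaw u y hyW, hy, hτ₀, zero_add]
    have hA'b : ∀ y, π y = c.symm p → π (Sr (u, y)) = s₀ ∧ Tr (u, Sr (u, y)) = y := fun y hy ↦ by
      have hyW : y ∈ W := hfibW _ (hbV p hp) (by simpa using hy)
      refine ⟨?_, hTrSr u y hyW⟩
      apply hτinj (hπW _ (hSrW u y hyW)) hs₀V
      have h := hlaw u (Sr (u, y)) (hSrW u y hyW)
      rw [hTrSr u y hyW, hy] at h
      rw [hτ₀]
      have h' : τ (π (Sr (u, y))) = τ (c.symm p) - u := by rw [h]; abel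
      rw [h', hu, sub_self]
    exact immersedFibre_comp hWo (hslice u hTr) (hslice u hSr) (fun y hy ↦ hTrW u y hy)
      (fun y hy ↦ hSrTr u y hy) (hfibW s₀ hs₀V) hAb hA'b hι₀.contMDiff_real
      hι₀.isClosedEmbedding.injective hι₀.injective_mfderiv_real hι₀.range_eq
  refine ⟨r, Φ, hr, hbt, fun p hp ↦ hVO (hbV p hp), fun x ↦ ?_, hπΦ, ?_, himm, fun p hp ↦ ?_⟩
  · -- (0) the central fibre
    change Tr (τ (c.symm (c s₀)), ι s₀ x) = ι s₀ x
    rw [c.left_inv hs₀c, hτ₀, hTr0 _ (hι₀W x)]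
  · -- (2) joint smoothness on `ball × X s₀`
    have hsymm : ContMDiffOn 𝓘(ℝ, EB) 𝓘(ℝ, EB) ∞ c.symm c.target := by
      rw [← hcℝ]; exact contMDiffOn_extChartAt_symm s₀
    have hu : ContMDiffOn 𝓘(ℝ, EB) 𝓘(ℝ, EuclideanSpace ℝ (Fin (Module.finrank ℝ EB))) ∞
        (fun p ↦ τ (c.symm p)) (ball (c s₀) r) :=
      hτ.comp (hsymm.mono hbt) fun p hp ↦ hbV p hp
    have hpair : ContMDiffOn (𝓘(ℝ, EB).prod 𝓘(ℝ, EX))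
        ((𝓘(ℝ, EuclideanSpace ℝ (Fin (Module.finrank ℝ EB)))).prod 𝓘(ℝ, E𝒳)) ∞
        (fun q : EB × X s₀ ↦ (τ (c.symm q.1), ι s₀ q.2)) (ball (c s₀) r ×ˢ univ) :=
      (hu.comp contMDiffOn_fst fun q hq ↦ hq.1).prodMk
        (hι₀.contMDiff_real.comp_contMDiffOn contMDiffOn_snd)
    refine (hTr.comp hpair fun q hq ↦ ⟨mem_univ _, hι₀W q.2⟩).congr fun q hq ↦ ?_
    rfl
  · -- (4) the diffeomorphism `X s₀ ≅ X (c⁻¹ p)`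
    obtain ⟨hsm, hinj, hd, hrange⟩ := himm p hp
    have hb : c.symm p ∈ O := hVO (hbV p hp)
    have hιb := hι _ hb
    haveI : CompactSpace (X s₀) := hι₀.compactSpace hπ.isProperMap
    haveI : CompactSpace (X (c.symm p)) := hιb.compactSpace hπ.isProperMap
    have h₁ : Manifold.IsSmoothEmbedding 𝓘(ℝ, EX) 𝓘(ℝ, E𝒳) ∞ (Φ p) :=
      Literature.Topology.FourManifolds.isSmoothEmbedding_of_injective_of_injective_mfderiv
        hsm (by simp) hinj hd
    have h₂ : Manifold.IsSmoothEmbedding 𝓘(ℝ, EX) 𝓘(ℝ, E𝒳) ∞ (ι (c.symm p)) :=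
      Literature.Topology.FourManifolds.isSmoothEmbedding_of_injective_of_injective_mfderiv
        hιb.contMDiff_real (by simp) hιb.isClosedEmbedding.injective hιb.injective_mfderiv_real
    exact exists_diffeomorph_comp_eq_of_range_eq h₁ h₂ (hrange.trans hιb.range_eq.symm)

end ChartBall

end Literature.Geometry.Kaehler

end
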